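import Literature.AlgebraicGeometry.Resolution.LocalBlowup
import HarnessLib

/-!
# The centre of a monomial chart with unit parameters (toric chart of the ring of invariants)

Topic: `Literature/AlgebraicGeometry/Resolution`. PROOF side of `CossartPiltant2019ReductionP`
(`ArithmeticalThreefoldsLocal.lean`), tenth brick of its one remaining input (C4) — descent of
local uniformization below the ramification field ([CoP1] Props. 9.3/9.5 with Lemma 9.4), on the
TORIC ROUTE: the maximal ideal of the ring of invariants `A = B^σ` of the diagonalised tame cyclic
action is generated by invariant monomials `x^h` (`TameCyclicMonomialStructure.lean`), and the
toric chart of the invariant lattice (`InvariantLatticeToricChart.lean`,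
`exists_invariant_toricChart`) provides Laurent monomials `y₁, …, y_d ∈ O` in which every such
`x^h` is a monomial `∏ yᵢ^{cᵢ}` — but, unlike the source's chart (53) with (c) "`W(yᵢ) ≥ 0`" read
strictly, some `yᵢ` may be UNITS of the valuation ring (`v(yᵢ) = 1`; e.g. the order valuation of
a point blowing up). `MonomialChartCentre.lean` computed the centre of `T = A[y]` when all `yᵢ`
have positive value; this file does the general case ([CoP1] proof of Lemma 9.4: "By (c),
`S₁ := S̄_{𝔪_W ∩ S̄}` is a local model of `W` and `S₁` is regular by (b)", HAL p. 29): with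
`T₀ := A[yᵢ : v(yᵢ) = 1]` the subring generated over `A` by the unit parameters,

* `exists_sum_mul_pos_of_mem_maximalIdeal` — PROVED: `𝔪_A ⊆ ∑_{v(yᵢ) < 1} yᵢ T` (a monomial
  generator of `𝔪_A` has positive value, so involves a `yᵢ` of positive value);
* `exists_add_sum_mul_pos_of_mem_adjoin` — PROVED: `T = T₀ + ∑_{v(yᵢ) < 1} yᵢ T`, and an element
  of positive value has its `T₀`-component of positive value;
* `exists_decomp_of_mem_maximalIdeal_locAtCentre` — PROVED: every element of positive value of
  the local ring `T_{𝔪_O ∩ T}` is `∑_{v(yᵢ) < 1} rᵢ yᵢ + q/g` with `rᵢ ∈ T_{𝔪_O ∩ T}`,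
  `q ∈ T₀` of positive value and `g ∈ T` of value `1`: the maximal ideal of the chart is
  generated by the `yᵢ` of positive value together with `𝔪_O ∩ T₀` — the input of the
  regularity count (`𝔪_O ∩ T₀` contributes `#{i : v(yᵢ) = 1}` generators modulo the others when
  the residues are algebraic, by the regularity of polynomial rings over the residue field).

Everything is PROVED; no named facts are introduced.

## Sources

* V. Cossart, O. Piltant, *Resolution of singularities of threefolds in positive characteristic.
  I*, J. Algebra 320 (2008) 1051–1082: proof of Lemma 9.4, (53)–(54) (HAL hal-00139124, p. 29).
  [CossartPiltant2008]
* W. Fulton, *Introduction to Toric Varieties*, Ann. of Math. Studies 131 (1993): §2.6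
  (pp. 45–50) (the affine charts `U_τ` of a nonsingular subdivision). [Fulton1993Toric]
-/

noncomputable section

namespace Literature.AlgebraicGeometry.Resolution

universe u

section Chart

variable {E : Type u} [Field E] (O : ValuationSubring E)

/-- **`T = T₀ + ∑_{v(yᵢ) < 1} yᵢ T`**: an element of `T = A[y₁, …, y_d]` is `q + ∑ rᵢ yᵢ` with
`q ∈ T₀ = A[yᵢ : v(yᵢ) = 1]`, `rᵢ ∈ T` and `rᵢ = 0` unless `v(yᵢ) < 1`; if moreover all
`yᵢ ∈ O`, `A ⊆ O` and the element has positive value, then so has `q` ([CoP1] proof of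
Lemma 9.4, the chart `S̄ = S[y₁, y₂, y₃]` of (53), here with unit parameters allowed).
[cite: CossartPiltant2008, proof of Lemma 9.4, (53) (HAL p. 29)] -/
theorem exists_add_sum_mul_pos_of_mem_adjoin (A : Subring E) (hAO : A ≤ O.toSubring) {d : ℕ}
    (y : Fin d → E) (hyO : ∀ i, y i ∈ O) {f : E}
    (hf : f ∈ Subring.closure ((A : Set E) ∪ Set.range y)) :
    ∃ q ∈ Subring.closure ((A : Set E) ∪ Set.range (fun i : {i : Fin d // O.valuation (y i) = 1} =>
        y i)),
      ∃ r : Fin d → E, (∀ i, r i ∈ Subring.closure ((A : Set E) ∪ Set.range y)) ∧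
        (∀ i, O.valuation (y i) = 1 → r i = 0) ∧ f = q + ∑ i, r i * y i ∧
        (O.valuation f < 1 → O.valuation q < 1) := by
  classical
  set T := Subring.closure ((A : Set E) ∪ Set.range y) with hT
  set T₀ := Subring.closure ((A : Set E) ∪ Set.range (fun i : {i : Fin d // O.valuation (y i) = 1} =>
    y i)) with hT₀
  have hTO : T ≤ O.toSubring := Subring.closure_le.mpr (Set.union_subset hAO (by
    rintro _ ⟨i, rfl⟩; exact hyO i))
  have hT₀T : T₀ ≤ T := Subring.closure_le.mpr (Set.union_subset
    (fun a ha => Subring.subset_closure (Set.mem_union_left _ ha))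
    (by rintro _ ⟨i, rfl⟩; exact Subring.subset_closure (Set.mem_union_right _ ⟨i.1, rfl⟩)))
  have hvalT : ∀ t ∈ T, O.valuation t ≤ 1 := fun t ht => (O.valuation_le_one_iff t).mpr (hTO ht)
  -- the positivity transfer, given a decomposition
  have hpos : ∀ (q : E) (r : Fin d → E), (∀ i, r i ∈ T) → (∀ i, O.valuation (y i) = 1 → r i = 0) →
      O.valuation (q + ∑ i, r i * y i) < 1 → O.valuation q < 1 := by
    intro q r hr hr0 hfv
    have htail : O.valuation (∑ i, r i * y i) < 1 := by
      refine O.valuation.map_sum_lt one_ne_zero fun i _ => ?_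
      by_cases hi : O.valuation (y i) = 1
      · rw [hr0 i hi, zero_mul, map_zero]; exact one_pos
      · rw [map_mul]
        have hlt : O.valuation (y i) < 1 :=
          lt_of_le_of_ne ((O.valuation_le_one_iff _).mpr (hyO i)) hi
        exact lt_of_le_of_lt (mul_le_of_le_one_left' (hvalT _ (hr i))) hlt
    have : q = (q + ∑ i, r i * y i) - ∑ i, r i * y i := by ring
    rw [this]
    exact O.valuation.map_sub_lt hfv htail
  -- the decomposition, by induction on the subring closure
  suffices h : ∃ q ∈ T₀, ∃ r : Fin d → E, (∀ i, r i ∈ T) ∧ (∀ i, O.valuation (y i) = 1 → r i = 0) ∧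
      f = q + ∑ i, r i * y i by
    obtain ⟨q, hq, r, hr, hr0, hfeq⟩ := h
    exact ⟨q, hq, r, hr, hr0, hfeq, fun hfv => hpos q r hr hr0 (hfeq ▸ hfv)⟩
  induction hf using Subring.closure_induction with
  | mem x hx =>
    rcases hx with hxA | ⟨i, rfl⟩
    · exact ⟨x, Subring.subset_closure (Set.mem_union_left _ hxA), 0, fun _ => T.zero_mem,
        fun _ _ => rfl, by simp⟩
    · by_cases hi : O.valuation (y i) = 1
      · exact ⟨y i, Subring.subset_closure (Set.mem_union_right _ ⟨⟨i, hi⟩, rfl⟩), 0,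
          fun _ => T.zero_mem, fun _ _ => rfl, by simp⟩
      · refine ⟨0, T₀.zero_mem, Pi.single i 1, fun j => ?_, fun j hj => ?_, ?_⟩
        · by_cases h : j = i
          · subst h; simp only [Pi.single_eq_same]; exact T.one_mem
          · rw [Pi.single_eq_of_ne h]; exact T.zero_mem
        · have h : j ≠ i := fun h => hi (h ▸ hj)
          rw [Pi.single_eq_of_ne h]
        · rw [zero_add, Finset.sum_eq_single i (fun j _ hj => by rw [Pi.single_eq_of_ne hj, zero_mul])
            (fun h => absurd (Finset.mem_univ i) h), Pi.single_eq_same, one_mul]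
  | zero => exact ⟨0, T₀.zero_mem, 0, fun _ => T.zero_mem, fun _ _ => rfl, by simp⟩
  | one => exact ⟨1, T₀.one_mem, 0, fun _ => T.zero_mem, fun _ _ => rfl, by simp⟩
  | add f g hf hg ihf ihg =>
    obtain ⟨a, ha, r, hr, hr0, rfl⟩ := ihf
    obtain ⟨b, hb, s, hs, hs0, rfl⟩ := ihg
    refine ⟨a + b, T₀.add_mem ha hb, r + s, fun i => T.add_mem (hr i) (hs i), fun i hi => ?_, ?_⟩
    · rw [Pi.add_apply, hr0 i hi, hs0 i hi, add_zero]
    · simp only [Pi.add_apply, add_mul, Finset.sum_add_distrib]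
      ring
  | neg f hf ihf =>
    obtain ⟨a, ha, r, hr, hr0, rfl⟩ := ihf
    refine ⟨-a, T₀.neg_mem ha, -r, fun i => T.neg_mem (hr i), fun i hi => ?_, ?_⟩
    · rw [Pi.neg_apply, hr0 i hi, neg_zero]
    · simp only [Pi.neg_apply, neg_mul, Finset.sum_neg_distrib]
      ring
  | mul f g hf hg ihf ihg =>
    obtain ⟨a, ha, r, hr, hr0, rfl⟩ := ihf
    obtain ⟨b, hb, s, hs, hs0, hgeq⟩ := ihg
    -- `(a + ∑ rᵢ yᵢ) g = a b + ∑ (a sᵢ + rᵢ g) yᵢ`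
    refine ⟨a * b, T₀.mul_mem ha hb, fun i => a * s i + r i * g,
      fun i => T.add_mem (T.mul_mem (hT₀T ha) (hs i)) (T.mul_mem (hr i) hg), fun i hi => ?_, ?_⟩
    · show a * s i + r i * g = 0
      rw [hr0 i hi, hs0 i hi, mul_zero, zero_mul, add_zero]
    · have hsum : (∑ i, (a * s i + r i * g) * y i) =
          a * (∑ i, s i * y i) + (∑ i, r i * y i) * g := by
        rw [Finset.mul_sum, Finset.sum_mul, ← Finset.sum_add_distrib]
        exact Finset.sum_congr rfl fun i _ => by ring
      show (a + ∑ i, r i * y i) * g = a * b + ∑ i, (a * s i + r i * g) * y i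
      rw [hsum, hgeq]
      ring

/-- **`𝔪_A ⊆ ∑_{v(yᵢ) < 1} yᵢ T`**: if the maximal ideal of the dominated local subring
`A ⊆ O` is generated by a set `G` of elements each of which is a monomial `∏ yᵢ^{cᵢ}` in
`y₁, …, y_d ∈ O`, then every element of `𝔪_A` is `∑ rᵢ yᵢ` with `rᵢ ∈ T = A[y]` and `rᵢ = 0`
unless `v(yᵢ) < 1` (a generator has positive value, hence involves some `yᵢ` of positive value
with a positive exponent). ([CoP1] proof of Lemma 9.4: the old parameters are monomials in the
`yᵢ` by (b) of (53); for the ring of invariants the generators are the invariant monomials.)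
[cite: CossartPiltant2008, proof of Lemma 9.4, (53)–(54) (HAL p. 29)] -/
theorem exists_sum_mul_pos_of_mem_maximalIdeal (A : Subring E) [IsLocalRing A]
    (hdom : ∀ a : A, a ∈ IsLocalRing.maximalIdeal A ↔ O.valuation (a : E) < 1)
    {d : ℕ} (y : Fin d → E) (hyO : ∀ i, y i ∈ O)
    (G : Set A) (hG : Ideal.span G = IsLocalRing.maximalIdeal A)
    (hGmon : ∀ g ∈ G, ∃ c : Fin d → ℕ, ((g : A) : E) = ∏ i, y i ^ c i)
    {a : A} (ha : a ∈ IsLocalRing.maximalIdeal A) :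
    ∃ r : Fin d → E, (∀ i, r i ∈ Subring.closure ((A : Set E) ∪ Set.range y)) ∧
      (∀ i, O.valuation (y i) = 1 → r i = 0) ∧ (a : E) = ∑ i, r i * y i := by
  classical
  set T := Subring.closure ((A : Set E) ∪ Set.range y) with hT
  have hyT : ∀ i, y i ∈ T := fun i => Subring.subset_closure (Set.mem_union_right _ ⟨i, rfl⟩)
  have hAT : ∀ a ∈ A, a ∈ T := fun a ha => Subring.subset_closure (Set.mem_union_left _ ha)
  rw [← hG] at ha
  refine Submodule.span_induction (p := fun b _ => ∃ r : Fin d → E, (∀ i, r i ∈ T) ∧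
      (∀ i, O.valuation (y i) = 1 → r i = 0) ∧ ((b : A) : E) = ∑ i, r i * y i) ?_ ?_ ?_ ?_ ha
  · intro g hg
    obtain ⟨c, hgc⟩ := hGmon g hg
    -- `g` has positive value, so some `yᵢ` with `cᵢ ≠ 0` has positive value
    have hgv : O.valuation ((g : A) : E) < 1 :=
      (hdom g).mp (hG ▸ Ideal.subset_span hg)
    obtain ⟨i₀, hi₀, hvi₀⟩ : ∃ i, c i ≠ 0 ∧ O.valuation (y i) < 1 := by
      by_contra hne
      push Not at hne
      have hone : O.valuation ((g : A) : E) = 1 := by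
        rw [hgc, map_prod]
        refine Finset.prod_eq_one fun i _ => ?_
        rw [map_pow]
        by_cases hci : c i = 0
        · rw [hci, pow_zero]
        · have h1 : O.valuation (y i) = 1 :=
            le_antisymm ((O.valuation_le_one_iff _).mpr (hyO i)) (hne i hci)
          rw [h1, one_pow]
      exact absurd hone hgv.ne
    -- `g = y_{i₀} · (y_{i₀}^{c_{i₀} - 1} ∏_{i ≠ i₀} yᵢ^{cᵢ})`
    set m : E := y i₀ ^ (c i₀ - 1) * ∏ i ∈ Finset.univ.erase i₀, y i ^ c i with hm
    have hmT : m ∈ T := T.mul_mem (T.pow_mem (hyT i₀) _) (T.prod_mem fun i _ => T.pow_mem (hyT i) _)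
    have hgm : ((g : A) : E) = m * y i₀ := by
      rw [hgc, ← Finset.mul_prod_erase Finset.univ (fun i => y i ^ c i) (Finset.mem_univ i₀), hm]
      have : y i₀ ^ c i₀ = y i₀ ^ (c i₀ - 1) * y i₀ := by
        rw [← pow_succ, Nat.sub_add_cancel (Nat.pos_of_ne_zero hi₀)]
      rw [this]; ring
    refine ⟨Pi.single i₀ m, fun i => ?_, fun i hi => ?_, ?_⟩
    · by_cases h : i = i₀
      · subst h; simp only [Pi.single_eq_same]; exact hmT
      · rw [Pi.single_eq_of_ne h]; exact T.zero_mem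
    · have h : i ≠ i₀ := fun h => by rw [h] at hi; exact absurd hi hvi₀.ne
      rw [Pi.single_eq_of_ne h]
    · rw [hgm, Finset.sum_eq_single i₀ (fun j _ hj => by rw [Pi.single_eq_of_ne hj, zero_mul])
        (fun h => absurd (Finset.mem_univ i₀) h), Pi.single_eq_same]
  · exact ⟨0, fun _ => T.zero_mem, fun _ _ => rfl, by simp⟩
  · rintro b₁ b₂ - - ⟨q₁, hq₁, hq₁0, h₁⟩ ⟨q₂, hq₂, hq₂0, h₂⟩
    refine ⟨q₁ + q₂, fun i => T.add_mem (hq₁ i) (hq₂ i), fun i hi => ?_, ?_⟩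
    · rw [Pi.add_apply, hq₁0 i hi, hq₂0 i hi, add_zero]
    · rw [Subring.coe_add, h₁, h₂, ← Finset.sum_add_distrib]
      exact Finset.sum_congr rfl fun i _ => by rw [Pi.add_apply, add_mul]
  · rintro w b - ⟨q, hq, hq0, hb⟩
    refine ⟨fun i => (w : E) * q i, fun i => T.mul_mem (hAT _ w.2) (hq i), fun i hi => ?_, ?_⟩
    · simp only [hq0 i hi, mul_zero]
    · rw [smul_eq_mul, Subring.coe_mul, hb, Finset.mul_sum]
      exact Finset.sum_congr rfl fun i _ => by ring

/-- **The centre of a monomial chart with unit parameters** ([CoP1] proof of Lemma 9.4,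
(53)–(54): "`S̄ := S[y₁, y₂, y₃]` … By (c), `S₁ := S̄_{𝔪_W ∩ S̄}` is a local model of `W`", HAL
p. 29; the same statement serves the toric chart over the ring of invariants,
`InvariantLatticeToricChart.lean`). Let `O` be a valuation ring of a field `E`, `A ⊆ O` a
subring and `y₁, …, y_d ∈ O`. Then every element of positive value of `T_{𝔪_O ∩ T}`,
`T := A[y₁, …, y_d]`, is `∑ᵢ rᵢ yᵢ + q / g` with `rᵢ ∈ T_{𝔪_O ∩ T}`, `rᵢ = 0` unless
`v(yᵢ) < 1`, `q ∈ T₀ := A[yᵢ : v(yᵢ) = 1]` of positive value and `g ∈ T` of value `1`: the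
maximal ideal of the chart is generated by the `yᵢ` of positive value and `𝔪_O ∩ T₀` (no
hypothesis on `A` is needed for this; when `𝔪_A` is generated by monomials in the `yᵢ`,
`exists_sum_mul_pos_of_mem_maximalIdeal` moves `𝔪_A ⊆ 𝔪_O ∩ T₀` into the `yᵢ` of positive
value, and for `T₀ = A`, i.e. all `v(yᵢ) < 1`, one recovers `MonomialChartCentre.lean`).
[cite: CossartPiltant2008, proof of Lemma 9.4, (53)–(54) and "S₁ is a local model of W" (HAL p. 29)]
[cite: Fulton1993Toric, Section 2.6 (pp. 45–50)] -/
theorem exists_decomp_of_mem_maximalIdeal_locAtCentre (A : Subring E) (hAO : A ≤ O.toSubring)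
    {d : ℕ} (y : Fin d → E) (hyO : ∀ i, y i ∈ O)
    {z : E} (hz : z ∈ locAtCentre (Subring.closure ((A : Set E) ∪ Set.range y)) O)
    (hzv : O.valuation z < 1) :
    ∃ r : Fin d → E, (∀ i, r i ∈ locAtCentre (Subring.closure ((A : Set E) ∪ Set.range y)) O) ∧
      (∀ i, O.valuation (y i) = 1 → r i = 0) ∧
      ∃ q ∈ Subring.closure ((A : Set E) ∪ Set.range
          (fun i : {i : Fin d // O.valuation (y i) = 1} => y i)),
        O.valuation q < 1 ∧ ∃ g ∈ Subring.closure ((A : Set E) ∪ Set.range y),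
          O.valuation g = 1 ∧ z = ∑ i, r i * y i + q / g := by
  classical
  set T := Subring.closure ((A : Set E) ∪ Set.range y) with hT
  set T₀ := Subring.closure ((A : Set E) ∪ Set.range (fun i : {i : Fin d // O.valuation (y i) = 1} =>
    y i)) with hT₀
  have hT₀T : T₀ ≤ T := Subring.closure_le.mpr (Set.union_subset
    (fun a ha => Subring.subset_closure (Set.mem_union_left _ ha))
    (by rintro _ ⟨i, rfl⟩; exact Subring.subset_closure (Set.mem_union_right _ ⟨i.1, rfl⟩)))
  have hAT : ∀ a ∈ A, a ∈ T := fun a ha => Subring.subset_closure (Set.mem_union_left _ ha)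
  -- Step 1: an element of `T` of positive value is `∑ rᵢ yᵢ + q`, `q ∈ T₀` of positive value,
  -- and its `A`-part can be moved into the `yᵢ` of positive value
  have hstep : ∀ f ∈ T, O.valuation f < 1 → ∃ r : Fin d → E, (∀ i, r i ∈ T) ∧
      (∀ i, O.valuation (y i) = 1 → r i = 0) ∧ ∃ q ∈ T₀, O.valuation q < 1 ∧
        f = ∑ i, r i * y i + q := by
    intro f hf hfv
    obtain ⟨q, hq, r, hr, hr0, hfeq, hqv⟩ := exists_add_sum_mul_pos_of_mem_adjoin O A hAO y hyO hf
    exact ⟨r, hr, hr0, q, hq, hqv hfv, by rw [hfeq, add_comm]⟩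
  -- Step 2: pass to the local ring `T_{𝔪_O ∩ T}`
  obtain ⟨f, hf, g, hg, hgv, rfl⟩ := mem_locAtCentre_iff.mp hz
  have hg0 : g ≠ 0 := ne_zero_of_valuation_eq_one hgv
  have hfv : O.valuation f < 1 := by
    have h := map_mul O.valuation (f / g) g
    rw [div_mul_cancel₀ f hg0, hgv, mul_one] at h
    rw [h]; exact hzv
  obtain ⟨r, hr, hr0, q, hq, hqv, hfq⟩ := hstep f hf hfv
  refine ⟨fun i => r i / g, fun i => mem_locAtCentre_iff.mpr ⟨r i, hr i, g, hg, hgv, rfl⟩,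
    fun i hi => by simp only [hr0 i hi, zero_div], q, hq, hqv, g, hg, hgv, ?_⟩
  show f / g = ∑ i, r i / g * y i + q / g
  rw [hfq, add_div, div_eq_mul_inv (∑ i, r i * y i) g, Finset.sum_mul]
  exact congrArg₂ (· + ·) (Finset.sum_congr rfl fun i _ => by ring) rfl

/-- In particular (the case used by the regularity count when no new parameter is a unit, cf.
`MonomialChartCentre.lean`): if every `yᵢ` has positive value then `𝔪_O ∩ T₀ = 𝔪_A ⊆ ∑ yᵢ T`,
and every element of positive value of `T_{𝔪_O ∩ T}` is `∑ rᵢ yᵢ`, `rᵢ ∈ T_{𝔪_O ∩ T}` — here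
derived from the unit-parameter form, as a consistency check of the two bricks.
[cite: CossartPiltant2008, proof of Lemma 9.4, (53)–(54) (HAL p. 29)] -/
theorem exists_sum_mul_of_mem_maximalIdeal_locAtCentre_of_forall_lt (A : Subring E) [IsLocalRing A]
    (hAO : A ≤ O.toSubring)
    (hdom : ∀ a : A, a ∈ IsLocalRing.maximalIdeal A ↔ O.valuation (a : E) < 1)
    {d : ℕ} (y : Fin d → E) (hyO : ∀ i, y i ∈ O) (hypos : ∀ i, O.valuation (y i) < 1)
    (G : Set A) (hG : Ideal.span G = IsLocalRing.maximalIdeal A)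
    (hGmon : ∀ g ∈ G, ∃ c : Fin d → ℕ, ((g : A) : E) = ∏ i, y i ^ c i)
    {z : E} (hz : z ∈ locAtCentre (Subring.closure ((A : Set E) ∪ Set.range y)) O)
    (hzv : O.valuation z < 1) :
    ∃ r : Fin d → E, (∀ i, r i ∈ locAtCentre (Subring.closure ((A : Set E) ∪ Set.range y)) O) ∧
      z = ∑ i, r i * y i := by
  classical
  set T := Subring.closure ((A : Set E) ∪ Set.range y) with hT
  obtain ⟨r, hr, -, q, hq, hqv, g, hg, hgv, hzeq⟩ :=
    exists_decomp_of_mem_maximalIdeal_locAtCentre O A hAO y hyO hz hzv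
  -- with no unit parameters `T₀ = A`, so `q ∈ 𝔪_A ⊆ ∑ yᵢ T`
  have hempty : IsEmpty {i : Fin d // O.valuation (y i) = 1} :=
    ⟨fun i => absurd i.2 (hypos i.1).ne⟩
  have hT₀ : Subring.closure ((A : Set E) ∪ Set.range
      (fun i : {i : Fin d // O.valuation (y i) = 1} => y i)) = A := by
    rw [Set.range_eq_empty, Set.union_empty, Subring.closure_eq]
  rw [hT₀] at hq
  have hqm : (⟨q, hq⟩ : A) ∈ IsLocalRing.maximalIdeal A := (hdom ⟨q, hq⟩).mpr hqv
  obtain ⟨s, hs, -, hqs⟩ := exists_sum_mul_pos_of_mem_maximalIdeal O A hdom y hyO G hG hGmon hqm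
  have hg0 : g ≠ 0 := ne_zero_of_valuation_eq_one hgv
  refine ⟨fun i => r i + s i / g, fun i => Subring.add_mem _ (hr i)
    (mem_locAtCentre_iff.mpr ⟨s i, hs i, g, hg, hgv, rfl⟩), ?_⟩
  show z = ∑ i, (r i + s i / g) * y i
  rw [hzeq, show q = ((⟨q, hq⟩ : A) : E) from rfl, hqs, div_eq_mul_inv (∑ i, s i * y i) g,
    Finset.sum_mul, ← Finset.sum_add_distrib]
  exact Finset.sum_congr rfl fun i _ => by ring

end Chart

end Literature.AlgebraicGeometry.Resolution

end
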